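import Summits.AtomisticToContinuum.Crystallization.Theorems.FrustratedLawDichotomyVacancyField

/-!
# FrustratedLawDichotomy · crux `AperiodicFrustratedLawGap` (stmt-AtomisticToContinuum-27623) — NO FINITE COVARIANT SELECTION
# (mass transport), the two-point Nash inequality with its pair term, and openness of deep holes with located witnesses
# (decomp-a2c, prover hand 1, direct share, generation 5; tools for the SHARP vacancy floor)

Three tools, each used by `FrustratedLawDichotomyVacancyFloorSharp` to remove the `1/12` from the vacancy floor of
`FrustratedLawDichotomyVacancyFloor` (deep holes far from the root cost no pair term; deep holes cannot stay near the root by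
mass transport):

* §1 `two_mul_rootEnergy_le_field_sub_of_nash` — the two-point inequality of the Nash clause WITH ITS PAIR TERM: for a rooted
  `δ`-hard-core `μ` whose root passes the crux's one-particle Nash test and a vacant `y`,
  `2·rootEnergy V_LJ μ ≤ Φ_μ(y) − V_LJ(dist y 0) ≤ Φ_μ(y) + (1/6)(dist y 0)⁻⁶` (part 1 kept only `+ 1/12`);
* §2 `exists_denseSeq_hole_near` — openness of the deep-hole set with LOCATED witnesses: a point `y` off a separated `S` with field
  `< c` has, within any `η > 0`, a term of the dense sequence off `S` with field `< c`;
* §3 **`ae_not_finite_nonempty_selection` — NO FINITE COVARIANT SELECTION** (the point-process form of «a unimodular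
  random network carries no covariant finite non-empty vertex set», Aldous–Lyons 2007 §2): for a point-stationary law almost surely
  carried by INFINITE rooted `δ`-hard-core configurations and a jointly measurable selection `Sel ⊆ (configurations) × ℝ³` which is
  covariant under re-rooting of hard-core configurations (`(θ_p μ, z − p) ∈ Sel ↔ (μ, z) ∈ Sel` for atoms `p`), almost surely the
  selected atoms are NOT a finite non-empty set: a.s. `¬ (0 < μ(Sel_μ) < ∞)`.  Proof: the Mecke identity with the transport
  «every selected atom receives mass `1/#Sel_μ` from every atom»: mass sent `= 1` on `{0 < #Sel < ∞}`, mass received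
  `= ∞ · 1[root selected, #Sel < ∞]`.

All `[folklore]`.
-/

noncomputable section

namespace Summit.AtomisticToContinuum.Crystallization.Theorems.FrustratedLawDichotomyNoFiniteSelection

open MeasureTheory Metric Set Filter Topology TopologicalSpace ProbabilityTheory
open scoped ENNReal BigOperators
open Literature.MathematicalPhysics.StatisticalMechanics Literature.Probability.Process
open Summit.AtomisticToContinuum.Crystallization.Theorems.ChargedEnergyGapNegative (E3 eStar)
open Summit.AtomisticToContinuum.Crystallization.Theorems.FrustratedLawDichotomyNashLocalStability (summable_inv_pow_six_of_sep)
open Summit.AtomisticToContinuum.Crystallization.Theorems.FrustratedLawDichotomyFiniteClusterGap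
  (setOf_count_restrict_singleton_ne_zero ae_mem_of_sep map_sub_univ)
open Summit.AtomisticToContinuum.Crystallization.Theorems.FrustratedLawDichotomyVacancyField

/-! ## §1. The two-point inequality with its pair term -/

section PairTerm

variable {δ : ℝ} {μ : Measure E3}

/-- **Two-point inequality of the Nash clause, with the pair term.**  For a rooted `δ`-hard-core `μ` whose root passes the
one-particle Nash test of the crux (clause (e) at `p = 0`, verbatim) and a vacant `y`:
`2·rootEnergy V_LJ μ ≤ Φ_μ(y) − V_LJ(dist y 0)` (field through its `ℝ≥0∞` parts). [folklore] -/
theorem two_mul_rootEnergy_le_field_sub_of_nash (hδ : 0 < δ) (hμ : IsRootedHardCore δ μ)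
    (hNash : ∀ y : E3, (∀ q : E3, μ {q} ≠ 0 → q ≠ 0 → y ≠ q) →
      ∑' q : {q : E3 // μ {q} ≠ 0 ∧ q ≠ 0}, lennardJones (dist (0 : E3) (q : E3)) ≤
        ∑' q : {q : E3 // μ {q} ≠ 0 ∧ q ≠ 0}, lennardJones (dist y (q : E3)))
    {y : E3} (hy : μ {y} = 0) :
    2 * rootEnergy lennardJones μ ≤
      (∫⁻ z, ENNReal.ofReal (lennardJones (dist y z)) ∂μ).toReal -
        (∫⁻ z, ENNReal.ofReal (-lennardJones (dist y z)) ∂μ).toReal - lennardJones (dist y (0 : E3)) := by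
  classical
  obtain ⟨S, h0, hsep, rfl⟩ := hμ
  have hmem := count_restrict_singleton_ne_zero_iff (E := E3) S
  have hyS : y ∉ S := fun h => (hmem y).2 h hy
  obtain ⟨ρ, hρ, hfar⟩ := exists_pos_forall_le_dist hδ hsep hyS
  have hN := hNash y fun q hq _ h => hyS (h ▸ (hmem q).1 hq)
  have hY : {q : E3 | (Measure.count : Measure E3).restrict S {q} ≠ 0 ∧ q ≠ 0} = S \ {0} := by
    ext q
    exact ⟨fun h => ⟨(hmem q).1 h.1, fun h0' => h.2 h0'⟩, fun h => ⟨(hmem q).2 h.1, fun h0' => h.2 h0'⟩⟩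
  have hL : ∑' q : {q : E3 // (Measure.count : Measure E3).restrict S {q} ≠ 0 ∧ q ≠ 0}, lennardJones (dist (0 : E3) (q : E3)) =
      ∑' q : ↥(S \ {0}), lennardJones (dist (0 : E3) (q : E3)) :=
    tsum_congr_set_coe (fun q : E3 => lennardJones (dist (0 : E3) q)) hY
  have hR : ∑' q : {q : E3 // (Measure.count : Measure E3).restrict S {q} ≠ 0 ∧ q ≠ 0}, lennardJones (dist y (q : E3)) =
      ∑' q : ↥(S \ {0}), lennardJones (dist y (q : E3)) :=
    tsum_congr_set_coe (fun q : E3 => lennardJones (dist y q)) hY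
  rw [hL, hR] at hN
  obtain ⟨-, -, hparts⟩ := tsum_lennardJones_dist_eq_parts hδ hsep hρ hfar
  have hsum := summable_lennardJones_dist hδ hsep hρ hfar
  have hsplit : ∑' q : S, lennardJones (dist y (q : E3)) =
      lennardJones (dist y (0 : E3)) + ∑' q : ↥(S \ {0}), lennardJones (dist y (q : E3)) := by
    rw [hsum.tsum_eq_add_tsum_ite ⟨0, h0⟩]
    congr 1
    set G : E3 → ℝ := fun x => if x = 0 then 0 else lennardJones (dist y x) with hG
    have h1 : (fun q : S => if q = ⟨0, h0⟩ then (0 : ℝ) else lennardJones (dist y (q : E3))) = fun q : S => G q := by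
      funext q
      by_cases hq : (q : E3) = 0
      · have : q = ⟨0, h0⟩ := Subtype.ext hq
        simp [hG, this]
      · have : q ≠ ⟨0, h0⟩ := fun h => hq (by rw [h])
        simp [hG, hq, this]
    have h2 : S.indicator G = (S \ {0}).indicator fun x => lennardJones (dist y x) := by
      funext x
      by_cases hx0 : x = 0
      · subst hx0; simp [hG, indicator]
      · by_cases hxS : x ∈ S
        · rw [indicator_of_mem hxS, indicator_of_mem (show x ∈ S \ {0} from ⟨hxS, hx0⟩)]; simp [hG, hx0]
        · rw [indicator_of_notMem hxS, indicator_of_notMem (fun h : x ∈ S \ {0} => hxS h.1)]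
    rw [h1, tsum_subtype S G, h2, ← tsum_subtype]
  rw [two_mul_rootEnergy_eq_tsum hδ h0 hsep, ← hparts]
  linarith

/-- The same with the pair term bounded by the attractive tail: `2·rootEnergy V_LJ μ ≤ Φ_μ(y) + (1/6)(dist y 0)⁻⁶` — a deep hole FAR
from the root bounds the root's one-particle energy by (almost) its depth. [folklore] -/
theorem two_mul_rootEnergy_le_field_add_tail_of_nash (hδ : 0 < δ) (hμ : IsRootedHardCore δ μ)
    (hNash : ∀ y : E3, (∀ q : E3, μ {q} ≠ 0 → q ≠ 0 → y ≠ q) →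
      ∑' q : {q : E3 // μ {q} ≠ 0 ∧ q ≠ 0}, lennardJones (dist (0 : E3) (q : E3)) ≤
        ∑' q : {q : E3 // μ {q} ≠ 0 ∧ q ≠ 0}, lennardJones (dist y (q : E3)))
    {y : E3} (hy : μ {y} = 0) :
    2 * rootEnergy lennardJones μ ≤
      (∫⁻ z, ENNReal.ofReal (lennardJones (dist y z)) ∂μ).toReal -
        (∫⁻ z, ENNReal.ofReal (-lennardJones (dist y z)) ∂μ).toReal + 1 / 6 * (dist y (0 : E3))⁻¹ ^ 6 := by
  have h := two_mul_rootEnergy_le_field_sub_of_nash hδ hμ hNash hy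
  have hV : -(1 / 6 * (dist y (0 : E3))⁻¹ ^ 6) ≤ lennardJones (dist y (0 : E3)) := by
    unfold lennardJones
    have h12 : 0 ≤ (dist y (0 : E3))⁻¹ ^ 12 := by positivity
    linarith
  linarith

end PairTerm

/-! ## §2. Openness of the deep-hole set, with located witnesses -/

section Near

variable {δ : ℝ} {S : Set E3}

/-- **Located dense witnesses of a deep hole.**  If the field of the `δ`-separated `S` at a point `y ∉ S` is `< c`, then for every
`η > 0` some term `d_n` of the dense sequence with `dist d_n y < η` is off `S` and has field `< c` there. [folklore] -/
theorem exists_denseSeq_hole_near (hδ : 0 < δ) (hsep : ∀ x ∈ S, ∀ z ∈ S, x ≠ z → δ ≤ dist x z) {y : E3} (hy : y ∉ S) {c : ℝ}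
    (hc : (∫⁻ z, ENNReal.ofReal (lennardJones (dist y z)) ∂((Measure.count : Measure E3).restrict S)).toReal -
      (∫⁻ z, ENNReal.ofReal (-lennardJones (dist y z)) ∂((Measure.count : Measure E3).restrict S)).toReal < c)
    {η : ℝ} (hη : 0 < η) :
    ∃ n : ℕ, denseSeq E3 n ∉ S ∧ dist (denseSeq E3 n) y < η ∧
      (∫⁻ z, ENNReal.ofReal (lennardJones (dist (denseSeq E3 n) z)) ∂((Measure.count : Measure E3).restrict S)).toReal -
        (∫⁻ z, ENNReal.ofReal (-lennardJones (dist (denseSeq E3 n) z)) ∂((Measure.count : Measure E3).restrict S)).toReal < c := by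
  obtain ⟨ρ, hρ, hfar⟩ := exists_pos_forall_le_dist hδ hsep hy
  set s : Set E3 := closedBall y (ρ / 2) with hs
  have hfar_s : ∀ y' ∈ s, ∀ q ∈ S, ρ / 2 ≤ dist y' q := by
    intro y' hy' q hq
    have h1 := hfar q hq
    have h2 : dist y' y ≤ ρ / 2 := mem_closedBall.1 hy'
    linarith [dist_triangle y y' q, dist_comm y y']
  set F : E3 → ℝ := fun y' => ∑' q : S, lennardJones (dist y' (q : E3)) with hF
  set δ' : ℝ := min δ (ρ / 2) with hδ'
  have hδ'0 : 0 < δ' := lt_min hδ (by linarith)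
  have hsep' : ∀ x ∈ S, ∀ z ∈ S, x ≠ z → δ' ≤ dist x z := fun x hx z hz hxz => (min_le_left _ _).trans (hsep x hx z hz hxz)
  have h6 : Summable fun q : S => (dist y (q : E3))⁻¹ ^ 6 :=
    summable_inv_pow_six_of_sep (S := S) (Y := S) hδ'0 hsep' subset_rfl fun q hq => (min_le_right _ _).trans (by linarith [hfar q hq])
  have hcont : ContinuousOn F s := by
    refine continuousOn_tsum (u := fun q : S => (1 / 12 * (δ' / 2)⁻¹ ^ 6 + 1 / 6) * (2 ^ 6 * (dist y (q : E3))⁻¹ ^ 6))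
      (fun q => continuousOn_lennardJones_dist (q : E3) fun y' hy' hq => ?_)
      ((h6.mul_left ((1 / 12 * (δ' / 2)⁻¹ ^ 6 + 1 / 6) * 2 ^ 6)).congr fun q => by ring) ?_
    · have := hfar_s y' hy' q q.2
      rw [hq, dist_self] at this
      linarith
    · intro q y' hy'
      rw [Real.norm_eq_abs]
      have hdq : ρ / 2 ≤ dist y' (q : E3) := hfar_s y' hy' q q.2
      have hδq : δ' / 2 ≤ dist y' (q : E3) := by linarith [min_le_right δ (ρ / 2), hδ'0]
      have hdpos : 0 < dist y' (q : E3) := by linarith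
      have hhalf : dist y (q : E3) / 2 ≤ dist y' (q : E3) := by
        have h2 : dist y' y ≤ ρ / 2 := mem_closedBall.1 hy'
        linarith [dist_triangle y y' q, dist_comm y y', hfar q q.2]
      have hyq : 0 < dist y (q : E3) := hρ.trans_le (hfar q q.2)
      have hinv1 : (dist y' (q : E3))⁻¹ ≤ 2 * (dist y (q : E3))⁻¹ := by
        rw [show 2 * (dist y (q : E3))⁻¹ = (dist y (q : E3) / 2)⁻¹ by field_simp]
        exact (inv_le_inv₀ hdpos (by positivity)).2 hhalf
      have hinv6 : (dist y' (q : E3))⁻¹ ^ 6 ≤ 2 ^ 6 * (dist y (q : E3))⁻¹ ^ 6 := by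
        rw [← mul_pow]; exact pow_le_pow_left₀ (inv_nonneg.2 hdpos.le) hinv1 6
      have hinvδ : (dist y' (q : E3))⁻¹ ^ 6 ≤ (δ' / 2)⁻¹ ^ 6 :=
        pow_le_pow_left₀ (inv_nonneg.2 hdpos.le) ((inv_le_inv₀ hdpos (by positivity)).2 hδq) 6
      have h6nn : 0 ≤ (dist y' (q : E3))⁻¹ ^ 6 := by positivity
      have h12 : (dist y' (q : E3))⁻¹ ^ 12 = (dist y' (q : E3))⁻¹ ^ 6 * (dist y' (q : E3))⁻¹ ^ 6 := by ring
      have hC : 0 ≤ 1 / 12 * (δ' / 2)⁻¹ ^ 6 + 1 / 6 := by positivity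
      calc |lennardJones (dist y' (q : E3))| ≤ 1 / 12 * (dist y' (q : E3))⁻¹ ^ 12 + 1 / 6 * (dist y' (q : E3))⁻¹ ^ 6 :=
            abs_lennardJones_le _
        _ ≤ (1 / 12 * (δ' / 2)⁻¹ ^ 6 + 1 / 6) * (dist y' (q : E3))⁻¹ ^ 6 := by
            rw [h12]; nlinarith [mul_le_mul_of_nonneg_left hinvδ h6nn]
        _ ≤ (1 / 12 * (δ' / 2)⁻¹ ^ 6 + 1 / 6) * (2 ^ 6 * (dist y (q : E3))⁻¹ ^ 6) := mul_le_mul_of_nonneg_left hinv6 hC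
  have hFy : F y < c := by
    rw [hF]
    simp only
    rw [(tsum_lennardJones_dist_eq_parts hδ hsep hρ hfar).2.2]
    exact hc
  have hys : y ∈ s := mem_closedBall_self (by linarith)
  have hev : ∀ᶠ y' in 𝓝[s] y, F y' < c := (hcont y hys).eventually (gt_mem_nhds hFy)
  obtain ⟨U, hUopen, hyU, hU⟩ := mem_nhdsWithin.1 hev
  have hopen : IsOpen (U ∩ ball y (min (ρ / 2) η)) := hUopen.inter isOpen_ball
  have hne : (U ∩ ball y (min (ρ / 2) η)).Nonempty := ⟨y, hyU, mem_ball_self (lt_min (by linarith) hη)⟩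
  obtain ⟨n, hn⟩ := (denseRange_denseSeq E3).exists_mem_open hopen hne
  have hnball := mem_ball.1 hn.2
  have hns : denseSeq E3 n ∈ s := mem_closedBall.2 (hnball.le.trans (min_le_left _ _))
  have hfar_n : ∀ q ∈ S, ρ / 2 ≤ dist (denseSeq E3 n) q := hfar_s _ hns
  have hnS : denseSeq E3 n ∉ S := fun h => by
    have := hfar_n _ h
    rw [dist_self] at this
    linarith
  refine ⟨n, hnS, hnball.trans_le (min_le_right _ _), ?_⟩
  rw [← (tsum_lennardJones_dist_eq_parts hδ hsep (by linarith : (0 : ℝ) < ρ / 2) hfar_n).2.2]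
  exact hU ⟨hn.1, hns⟩

end Near

/-! ## §3. No finite covariant selection (mass transport) -/

section Selection

variable {δ : ℝ} {P : Measure (Measure E3)}

/-- **NO FINITE COVARIANT SELECTION.**  Let `P` be a finite point-stationary law almost surely carried by INFINITE rooted
`δ`-hard-core configurations, and `Sel ⊆ (configurations) × ℝ³` a jointly measurable selection, covariant under re-rooting of rooted
hard-core configurations: `(θ_p μ, z − p) ∈ Sel ↔ (μ, z) ∈ Sel` for every atom `p` of `μ` and every `z`.  Then almost surely the
selected atoms are not a finite non-empty set: `¬ (0 < μ {z | (μ, z) ∈ Sel} < ∞)`.  Mass transport: «every selected atom receives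
`1/#Sel_μ` from every atom» has out-flow `1` on this event and in-flow `∞ · 1[root selected, #Sel_μ < ∞]`. [folklore] -/
theorem ae_not_finite_nonempty_selection (hδ : 0 < δ) [IsFiniteMeasure P] (hcore : ∀ᵐ μ ∂P, IsRootedHardCore δ μ)
    (hinf : ∀ᵐ μ ∂P, μ univ = ∞) (hstat : IsPointStationaryLaw P) {Sel : Set (Measure E3 × E3)} (hSel : MeasurableSet Sel)
    (hcov : ∀ μ : Measure E3, IsRootedHardCore δ μ → ∀ p : E3, μ {p} ≠ 0 → ∀ z : E3,
      ((Measure.map (fun w : E3 => w - p) μ, z - p) ∈ Sel ↔ (μ, z) ∈ Sel)) :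
    ∀ᵐ μ ∂P, ¬ (0 < μ {z | (μ, z) ∈ Sel} ∧ μ {z | (μ, z) ∈ Sel} < ∞) := by
  classical
  obtain ⟨κ, hκs, hκS⟩ := FrustratedLawDichotomyFiniteClusterGap.exists_kernel_eq_count_restrict hδ
  have hκ : ∀ μ : Measure E3, IsRootedHardCore δ μ → κ μ = μ := by
    rintro μ ⟨S, -, hsep, rfl⟩; exact hκS S hsep
  -- the selection indicator and the number of selected atoms (through the kernel, for measurability)
  set χ : Measure E3 × E3 → ℝ≥0∞ := Sel.indicator 1 with hχ
  have hχm : Measurable χ := measurable_one.indicator hSel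
  have hχμ : ∀ μ : Measure E3, (fun z => χ (μ, z)) = {z | (μ, z) ∈ Sel}.indicator 1 := fun μ => by
    funext z; by_cases h : (μ, z) ∈ Sel <;> simp [hχ, h]
  set N : Measure E3 → ℝ≥0∞ := fun μ => κ μ (Prod.mk μ ⁻¹' Sel) with hN
  have hNm : Measurable N := Kernel.measurable_kernel_prodMk_left hSel
  have hNμ : ∀ μ : Measure E3, IsRootedHardCore δ μ → N μ = μ {z | (μ, z) ∈ Sel} := fun μ hμ => by
    simp only [hN, hκ μ hμ]; rfl
  -- the transport `g(μ, z) = 1[(μ, z) ∈ Sel] / N(μ)`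
  set g : Measure E3 → E3 → ℝ≥0∞ := fun μ z => χ (μ, z) * (N μ)⁻¹ with hg
  have hgm : Measurable (Function.uncurry g) := hχm.mul ((hNm.comp measurable_fst).inv)
  have key := hstat g hgm
  -- the events
  set K : Set (Measure E3) := {μ : Measure E3 | 0 < N μ ∧ N μ < ∞} with hK
  have hKm : MeasurableSet K := (measurableSet_lt measurable_const hNm).inter (measurableSet_lt hNm measurable_const)
  set A : Set (Measure E3) := {μ : Measure E3 | (μ, (0 : E3)) ∈ Sel ∧ N μ < ∞} with hA
  have hAm : MeasurableSet A := (measurable_prodMk_right hSel).inter (measurableSet_lt hNm measurable_const)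
  -- out-flow: `1` on `K`, `0` off `K`
  have hout : ∀ᵐ μ ∂P, ∫⁻ z, g μ z ∂μ = K.indicator 1 μ := by
    filter_upwards [hcore] with μ hμ
    have hNμ' := hNμ μ hμ
    have hmz : Measurable fun z : E3 => χ (μ, z) := hχm.comp measurable_prodMk_left
    have h1 : ∫⁻ z, g μ z ∂μ = N μ * (N μ)⁻¹ := by
      simp only [hg]
      rw [lintegral_mul_const _ hmz, hχμ μ,
        lintegral_indicator_one (show MeasurableSet {z : E3 | (μ, z) ∈ Sel} from measurable_prodMk_left hSel), ← hNμ']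
    rw [h1]
    by_cases hK' : μ ∈ K
    · rw [indicator_of_mem hK', Pi.one_apply, ENNReal.mul_inv_cancel hK'.1.ne' hK'.2.ne]
    · rw [indicator_of_notMem hK']
      rw [hK, mem_setOf_eq, not_and_or, not_lt, not_lt, le_zero_iff, top_le_iff] at hK'
      rcases hK' with h0 | htop
      · rw [h0, zero_mul]
      · rw [htop, ENNReal.inv_top, mul_zero]
  -- in-flow: `∞ · 1[A]`
  have hin : ∀ᵐ μ ∂P, ∫⁻ y, g (Measure.map (fun w : E3 => w - y) μ) (-y) ∂μ = A.indicator (fun _ => ∞) μ := by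
    filter_upwards [hcore, hinf] with μ hμ hμinf
    have hμ' := hμ
    obtain ⟨S, h0, hsep, rfl⟩ := hμ
    -- at every atom `y`, the integrand is `χ(μ, 0) / N μ`
    have hae : ∀ᵐ y ∂((Measure.count : Measure E3).restrict S),
        g (Measure.map (fun w : E3 => w - y) ((Measure.count : Measure E3).restrict S)) (-y) =
          χ ((Measure.count : Measure E3).restrict S, 0) * (N ((Measure.count : Measure E3).restrict S))⁻¹ := by
      refine (ae_mem_of_sep hδ hsep).mono fun y hy => ?_
      have hy' : (Measure.count : Measure E3).restrict S {y} ≠ 0 := (count_restrict_singleton_ne_zero_iff S y).2 hy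
      have hθ : IsRootedHardCore δ (Measure.map (fun w : E3 => w - y) ((Measure.count : Measure E3).restrict S)) := hμ'.map_sub hy'
      simp only [hg]
      congr 1
      · -- `χ(θ_y μ, -y) = χ(μ, 0)` by covariance at `z = 0`
        have h := hcov _ hμ' y hy' 0
        rw [zero_sub] at h
        simp only [hχ]
        by_cases hm : ((Measure.count : Measure E3).restrict S, (0 : E3)) ∈ Sel
        · rw [indicator_of_mem hm, indicator_of_mem (h.2 hm), Pi.one_apply, Pi.one_apply]
        · rw [indicator_of_notMem hm, indicator_of_notMem (fun h' => hm (h.1 h'))]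
      · -- `N(θ_y μ) = N(μ)` by covariance
        congr 1
        rw [hNμ _ hθ, hNμ _ hμ', Measure.map_apply (measurable_sub_const y)
          (show MeasurableSet {z : E3 | (Measure.map (fun w : E3 => w - y) ((Measure.count : Measure E3).restrict S), z) ∈ Sel}
            from measurable_prodMk_left hSel)]
        congr 1
        ext w
        simp only [mem_preimage, mem_setOf_eq]
        exact hcov _ hμ' y hy' w
    rw [lintegral_congr_ae hae, lintegral_const, hμinf]
    by_cases hA' : (Measure.count : Measure E3).restrict S ∈ A
    · rw [indicator_of_mem hA']
      have h1 : χ ((Measure.count : Measure E3).restrict S, 0) = 1 := by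
        simp only [hχ]; rw [indicator_of_mem hA'.1, Pi.one_apply]
      rw [h1, one_mul, ENNReal.mul_top (ENNReal.inv_ne_zero.2 hA'.2.ne)]
    · rw [indicator_of_notMem hA']
      rw [hA, mem_setOf_eq, not_and_or, not_lt, top_le_iff] at hA'
      rcases hA' with h0 | htop
      · have h1 : χ ((Measure.count : Measure E3).restrict S, 0) = 0 := by
          simp only [hχ]; rw [indicator_of_notMem h0]
        rw [h1, zero_mul, zero_mul]
      · rw [htop, ENNReal.inv_top, mul_zero, zero_mul]
  -- the Mecke identity: `P K = ∞ · P A`, so both vanish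
  rw [lintegral_congr_ae hout, lintegral_congr_ae hin, lintegral_indicator_one hKm, lintegral_indicator_const hAm] at key
  have hPA : P A = 0 := by
    by_contra h
    rw [ENNReal.top_mul h] at key
    exact (measure_lt_top P K).ne key
  rw [hPA, mul_zero] at key
  -- conclusion, almost surely
  filter_upwards [hcore, (measure_eq_zero_iff_ae_notMem.1 key)] with μ hμ hμK
  rw [hK, mem_setOf_eq, hNμ μ hμ] at hμK
  exact hμK

end Selection


end Summit.AtomisticToContinuum.Crystallization.Theorems.FrustratedLawDichotomyNoFiniteSelection

end
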